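import Summits.QuantumFields.BalabanUV.Beta.GAN24.S3ShapeL0Contraction
import Literature.MathematicalPhysics.QuantumFieldTheory.Balaban1983to89.Beta.AveragingHessianKernelsRooted

/-!
# `BalabanUV.Beta.GAN24.S3ShapeL0ContractionAt` — binder row G-an2-4 / (CONV-C), road S3 AT THE IN-BLOCK ROOT: the first half of package (ρ-d)-L0 of the row owner
# gan24-p1-g21's WANTED «ROOTED-S3-Λ» ([GAN24P1-G21-ONLINE] (W5)) — **`S3ShapeL0Contraction` RE-RUN FOR an1's ROOTED TABLE `hessFFAt (toSite r) Lc`** (box root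
# `r ∈ box (d+1) Lc`): the vertex contraction of the ROOTED level-0 Λ table `SLam Lc (lamCoeffOf (KInv Lc) Lc) (hessFFAt ρ Lc)` and its synthetic sandwich pair, with the
# SAME constants (support box, `2ℓ²`, column mass) as the base module

NOT IN PRINT; OUR BOOKKEEPING (G-an2-4 formalisation swarm → CRUX TEAM (2), leaf prover `b2b-balaban-gan24-formalise-leaf-01`, gen 60; BACKUP typing for the (ρ-d) takers
(first refusal leaf-04 g55 ∕ leaf-05 g45 per the owner; see journal); METHOD = the owner's gen-6 `mkroot.py` rule: same theorem names (with `hessFF ↦ hessFFAt` inside names) in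
the `…At` namespace, `hessFF Lc ↦ hessFFAt (toSite r) Lc`, an1's rooted `hessFFAt_inl_inl` ∕ `hessKerAt_eq_zero_left ∕ _right hr` ∕ `abs_hessKerAt_le … hr`, one extra binder
`(hr : r ∈ box (d+1) Lc)` on the six root-dependent theorems; the root-free ones (`exists_wH_bound`, `exists_lamCoeffOf_bound`, `summable_wH_mul_lamCoeffOf`, `mem_nearBox_of_near`,
`mem_colBox_iff`, `card_colBox`, `l1_le_of_mem_colBox`, `leg_onLat`) BY NAME from the base; base module untouched).  [folklore]; 0 `def`, 0 cited facts, 0 `def … : Prop`,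
0 sorry; NO estimate beyond the base's per-`N` existentials (summability only).  HONEST FRAMING (cell contract, verbatim): «discharging `BetaPertH` makes Bałaban's UV stability
UNCONDITIONAL — a real constructive-QFT result; it is NOT the continuum limit and NOT the Clay problem.»  HONEST DEPENDENCY (verbatim): «continuum YM on T⁴ ⇐ BetaPertH ∧ nine
spine estimates (0/9 proved); BetaPertH ⇐ (D1) ∧ (D4) ∧ CAP+tail; G-an2-4 gates asym, D1 and NE2/3/4.»

## What (generic `d`, any blocking `N`, fixed `Lc`, box root)
§1-ρ `hessFFAt_eq_zero_of_not_mem`, **`SLam0_eq_finset_sum`** (the rooted level-0 table at a fixed field leg is a FINITE coarse-bond sum over the same box as the base),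
**`inner_eq_onLat`** (THE VERTEX CONTRACTION with the synthetic pair `H′ μ u := onLat Lc (yy ↦ ν·β(μ,yy)) u`, `T′ μ u := onLat Lc (yy ↦ −hessFFAt ρ Lc μ yy) u` — the bracket
`β` is root-free).
§2-ρ **`support_onLat_hessFFAt`** (finite column support, radius `2Lc`), **`abs_onLat_hessFFAt_le`** (`≤ 2ℓ²`), **`mass_onLat_hessFFAt`** (the `N`-free column mass, same number); the
vertex-leg letter `leg_onLat` is root-free (BY NAME).
USE: `S3ShapeL0At` (the second half of (ρ-d)-L0: `rowL0_holds_at`) reads these where `S3ShapeL0` reads the base.  Discharges NOTHING of (hS, hSall); NEVER «G-an2-4 closed»;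
NOT D1, NOT BetaPertH, NOT continuum, NOT Clay.
-/

noncomputable section

open Finset
open scoped BigOperators
open Literature.MathematicalPhysics.QuantumFieldTheory
open Literature.MathematicalPhysics.QuantumFieldTheory.Balaban1983to89
open Literature.MathematicalPhysics.QuantumFieldTheory.Balaban1983to89.Beta
open Literature.Probability.LatticeModels (Torus.proj)
open B12Sec2to5 (l1 l1_nonneg)
open ExpKernelCalculus (MKer Zl BiLoc Decays)
open LatticeForm (quo)
open KernelSpecInstance (wH)
open KKTFluctuationKernel (GamΦ)
open OneStepResolventKernel (Fib LocStencil KInv)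
open AffineAveraging (box toSite)
open AveragingHessianKernels (hessFF hessKer Near ell)
open AveragingHessianKernelsRooted (hessFFAt hessKerAt hessFFAt_inl_inl hessKerAt_eq_zero_left hessKerAt_eq_zero_right abs_hessKerAt_le hessFFAt_zero)
open InterLevelTransport (SLam cwsum cwsum_apply onLat onLat_zsmul onLat_off)
open BalabanStepJets (lamCoeffOf)
open Summit.QuantumFields.BalabanUV.Beta.GAN24.S3ShapeL0Contraction (exists_wH_bound exists_lamCoeffOf_bound summable_wH_mul_lamCoeffOf mem_nearBox_of_near
  mem_colBox_iff card_colBox l1_le_of_mem_colBox leg_onLat)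

namespace Summit.QuantumFields.BalabanUV.Beta.GAN24.S3ShapeL0ContractionAt

variable {d : ℕ}

/-! ## §1-ρ The vertex contraction of the rooted level-0 Λ table -/

section Contraction

variable {N Lc : ℕ} [NeZero N] [NeZero Lc] {r : Fin (d + 1) → ℕ}

/-- [folklore] Off the box the constraint Hessian of the coarse bond `(μ, yy)` does not see the field leg `w`. -/
theorem hessFFAt_eq_zero_of_not_mem (hr : r ∈ box (d + 1) Lc) {yy w : Fin (d + 1) → ℤ}
    (h : yy ∉ Fintype.piFinset fun i => Finset.Icc (quo Lc w i - 1) (quo Lc w i)) (μ : Fin (d + 1))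
    (y : Fin (d + 1) → ℤ) (l l' : Fin (d + 1)) : hessFFAt (toSite r) Lc μ yy w y (Sum.inl l) (Sum.inl l') = 0 := by
  rw [hessFFAt_inl_inl]
  exact hessKerAt_eq_zero_left hr (f := (l, w)) (fun hn => h (mem_nearBox_of_near hn)) _

/-- [folklore] **THE LEVEL-0 Λ TABLE AT A FIXED FIELD LEG IS A FINITE COARSE-BOND SUM**:
`SLam Lc c hessFF κ″ u w y (inl l) (inl l′) = −Σ_μ Σ_{yy ∈ box(w)} c μ yy κ″ u · hessFFAt (toSite r) Lc μ yy w y (inl l) (inl l′)`. -/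
theorem SLam0_eq_finset_sum (hr : r ∈ box (d + 1) Lc) (κ'' : Fin (d + 1)) (u w y : Fin (d + 1) → ℤ) (l l' : Fin (d + 1)) :
    SLam Lc (lamCoeffOf (KInv (N := Lc) (d := d)) Lc) (fun μ y => hessFFAt (toSite r) Lc μ y) κ'' u w y (Sum.inl l) (Sum.inl l') =
      -∑ μ : Fin (d + 1), ∑ yy ∈ Fintype.piFinset (fun i => Finset.Icc (quo Lc w i - 1) (quo Lc w i)),
        lamCoeffOf (KInv (N := Lc) (d := d)) Lc μ yy κ'' u * hessFFAt (toSite r) Lc μ yy w y (Sum.inl l) (Sum.inl l') := by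
  simp only [SLam, cwsum_apply]
  congr 1
  refine Finset.sum_congr rfl fun μ _ => ?_
  exact tsum_eq_sum fun yy hyy => by rw [hessFFAt_eq_zero_of_not_mem hr hyy, mul_zero]

/-- **THE VERTEX CONTRACTION** [folklore] (kernel identity, generic `d`, any blocking `N`, fixed `Lc`): in the one-channel unit
sandwich of the level-`0` Λ table the vertex leg `ν·wH_N κ″ κ′ (u − N•u′)` and the table `SLam Lc (lamCoeffOf (KInv Lc) Lc) hessFF`
can be replaced by the SYNTHETIC pair (supported on the coarse sublattice `Lc•ℤ^{d+1}`, fibre slot = the coarse direction `μ`)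
`H′ μ u := onLat Lc (yy ↦ ν·β(μ,yy)) u`, `T′ μ u := onLat Lc (yy ↦ −hessFFAt (toSite r) Lc μ yy) u`, where
`β(μ,yy) := Σ_{κ″} Σ'_v wH_N κ″ κ′ (v − N•u′)·lamCoeffOf (KInv Lc) Lc μ yy κ″ v` is THE BRACKET — without changing the value. -/
theorem inner_eq_onLat (hr : r ∈ box (d + 1) Lc) (ν c : ℝ) (κ' : Fin (d + 1)) (u' w y : Fin (d + 1) → ℤ) (l l' : Fin (d + 1)) :
    (∑ κ'' : Fin (d + 1), c * ∑' u : Fin (d + 1) → ℤ,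
        (ν * wH (N := N) κ'' κ' (u - (N : ℤ) • u')) *
          SLam Lc (lamCoeffOf (KInv (N := Lc) (d := d)) Lc) (fun μ y => hessFFAt (toSite r) Lc μ y) κ'' u w y (Sum.inl l) (Sum.inl l')) =
      ∑ μ : Fin (d + 1), c * ∑' u : Fin (d + 1) → ℤ,
        onLat Lc (fun yy => ν * ∑ κ'' : Fin (d + 1), ∑' v : Fin (d + 1) → ℤ,
            wH (N := N) κ'' κ' (v - (N : ℤ) • u') * lamCoeffOf (KInv (N := Lc) (d := d)) Lc μ yy κ'' v) u *
          onLat Lc (fun yy => -hessFFAt (toSite r) Lc μ yy) u w y (Sum.inl l) (Sum.inl l') := by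
  set F : Finset (Fin (d + 1) → ℤ) := Fintype.piFinset (fun i => Finset.Icc (quo Lc w i - 1) (quo Lc w i)) with hF
  set lam := lamCoeffOf (KInv (N := Lc) (d := d)) Lc with hlam
  -- LHS: finite coarse-bond sum pulled through the `u`-series
  have hL : ∀ κ'' : Fin (d + 1),
      ∑' u : Fin (d + 1) → ℤ, (ν * wH (N := N) κ'' κ' (u - (N : ℤ) • u')) *
          SLam Lc lam (fun μ y => hessFFAt (toSite r) Lc μ y) κ'' u w y (Sum.inl l) (Sum.inl l') =
        -∑ μ : Fin (d + 1), ∑ yy ∈ F, hessFFAt (toSite r) Lc μ yy w y (Sum.inl l) (Sum.inl l') *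
          (ν * ∑' u : Fin (d + 1) → ℤ, wH (N := N) κ'' κ' (u - (N : ℤ) • u') * lam μ yy κ'' u) := by
    intro κ''
    have hsum : ∀ μ yy, Summable fun u : Fin (d + 1) → ℤ =>
        hessFFAt (toSite r) Lc μ yy w y (Sum.inl l) (Sum.inl l') * (ν * (wH (N := N) κ'' κ' (u - (N : ℤ) • u') * lam μ yy κ'' u)) :=
      fun μ yy => ((summable_wH_mul_lamCoeffOf (N := N) (Lc := Lc) κ'' κ' μ u' yy).mul_left ν).mul_left _
    calc ∑' u : Fin (d + 1) → ℤ, (ν * wH (N := N) κ'' κ' (u - (N : ℤ) • u')) *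
            SLam Lc lam (fun μ y => hessFFAt (toSite r) Lc μ y) κ'' u w y (Sum.inl l) (Sum.inl l')
        = ∑' u : Fin (d + 1) → ℤ, -∑ μ : Fin (d + 1), ∑ yy ∈ F,
            hessFFAt (toSite r) Lc μ yy w y (Sum.inl l) (Sum.inl l') * (ν * (wH (N := N) κ'' κ' (u - (N : ℤ) • u') * lam μ yy κ'' u)) := by
          refine tsum_congr fun u => ?_
          rw [hlam, SLam0_eq_finset_sum hr, ← hlam, mul_neg, Finset.mul_sum]
          congr 1
          refine Finset.sum_congr rfl fun μ _ => ?_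
          rw [Finset.mul_sum]
          exact Finset.sum_congr rfl fun yy _ => by ring
      _ = -∑ μ : Fin (d + 1), ∑ yy ∈ F, ∑' u : Fin (d + 1) → ℤ,
            hessFFAt (toSite r) Lc μ yy w y (Sum.inl l) (Sum.inl l') * (ν * (wH (N := N) κ'' κ' (u - (N : ℤ) • u') * lam μ yy κ'' u)) := by
          rw [tsum_neg, Summable.tsum_finsetSum (fun μ _ => summable_sum fun yy _ => hsum μ yy)]
          congr 1
          exact Finset.sum_congr rfl fun μ _ => Summable.tsum_finsetSum fun yy _ => hsum μ yy
      _ = _ := by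
          congr 1
          refine Finset.sum_congr rfl fun μ _ => Finset.sum_congr rfl fun yy _ => ?_
          rw [tsum_mul_left, tsum_mul_left]
  -- RHS: the synthetic pair is a `cwsum`, hence the coarse sum, hence the same finite sum
  have hR : ∀ μ : Fin (d + 1),
      ∑' u : Fin (d + 1) → ℤ,
        onLat Lc (fun yy => ν * ∑ κ'' : Fin (d + 1), ∑' v : Fin (d + 1) → ℤ,
            wH (N := N) κ'' κ' (v - (N : ℤ) • u') * lam μ yy κ'' v) u *
          onLat Lc (fun yy => -hessFFAt (toSite r) Lc μ yy) u w y (Sum.inl l) (Sum.inl l') =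
        ∑ yy ∈ F, (ν * ∑ κ'' : Fin (d + 1), ∑' v : Fin (d + 1) → ℤ,
            wH (N := N) κ'' κ' (v - (N : ℤ) • u') * lam μ yy κ'' v) * -hessFFAt (toSite r) Lc μ yy w y (Sum.inl l) (Sum.inl l') := by
    intro μ
    have h1 := cwsum_apply (N := Lc) (fun yy => ν * ∑ κ'' : Fin (d + 1), ∑' v : Fin (d + 1) → ℤ,
        wH (N := N) κ'' κ' (v - (N : ℤ) • u') * lam μ yy κ'' v) (fun yy => -hessFFAt (toSite r) Lc μ yy) w y (Sum.inl l) (Sum.inl l')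
    simp only [cwsum, OneStepResolventKernel.wsum] at h1
    rw [h1]
    refine tsum_eq_sum fun yy hyy => ?_
    rw [Pi.neg_apply, Pi.neg_apply, Pi.neg_apply, Pi.neg_apply, hessFFAt_eq_zero_of_not_mem hr hyy, neg_zero, mul_zero]
  simp_rw [hL, hR]
  -- both sides are the same finite double sum
  rw [show (∑ κ'' : Fin (d + 1), c * -∑ μ : Fin (d + 1), ∑ yy ∈ F, hessFFAt (toSite r) Lc μ yy w y (Sum.inl l) (Sum.inl l') *
        (ν * ∑' u : Fin (d + 1) → ℤ, wH (N := N) κ'' κ' (u - (N : ℤ) • u') * lam μ yy κ'' u)) =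
      ∑ μ : Fin (d + 1), c * ∑ yy ∈ F, ∑ κ'' : Fin (d + 1), -(hessFFAt (toSite r) Lc μ yy w y (Sum.inl l) (Sum.inl l') *
        (ν * ∑' u : Fin (d + 1) → ℤ, wH (N := N) κ'' κ' (u - (N : ℤ) • u') * lam μ yy κ'' u)) by
    simp only [mul_neg, Finset.mul_sum, ← Finset.sum_neg_distrib]
    rw [Finset.sum_comm]
    refine Finset.sum_congr rfl fun μ _ => ?_
    rw [Finset.sum_comm]]
  refine Finset.sum_congr rfl fun μ _ => ?_
  congr 1
  refine Finset.sum_congr rfl fun yy _ => ?_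
  rw [Finset.mul_sum, Finset.sum_mul]
  refine Finset.sum_congr rfl fun κ'' _ => ?_
  ring

end Contraction

/-! ## §2-ρ The synthetic pair for the rooted table: finite column support, bounded column mass -/

section Synthetic

variable {N Lc : ℕ} [NeZero N] [NeZero Lc] {r : Fin (d + 1) → ℕ}

/-- [folklore] **FINITE COLUMN SUPPORT OF THE SYNTHETIC TABLE**: if `T′ μ u w l y l′ ≠ 0` then `u = Lc•yy` is a coarse point whose
support box contains both field legs `w` and `y`; hence `w` and `u` lie in the column box of `y` of radius `2Lc`. -/
theorem support_onLat_hessFFAt (hr : r ∈ box (d + 1) Lc) {μ : Fin (d + 1)} {u w y : Fin (d + 1) → ℤ} {l l' : Fin (d + 1)}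
    (h : onLat Lc (fun yy => -hessFFAt (toSite r) Lc μ yy) u w y (Sum.inl l) (Sum.inl l') ≠ 0) :
    w ∈ Fintype.piFinset (fun i => Finset.Icc (y i - ((2 * Lc : ℕ) : ℤ)) (y i + ((2 * Lc : ℕ) : ℤ))) ∧
      u ∈ Fintype.piFinset (fun i => Finset.Icc (y i - ((2 * Lc : ℕ) : ℤ)) (y i + ((2 * Lc : ℕ) : ℤ))) := by
  have hL1 : 1 ≤ Lc := Nat.one_le_iff_ne_zero.mpr (NeZero.ne Lc)
  by_cases hu : Torus.proj Lc u = 0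
  · have e := OneStepResolventKernel.eq_zsmul_quo_of_proj (N := Lc) hu
    simp only [onLat, hu, if_true, Pi.neg_apply, ne_eq, neg_eq_zero, hessFFAt_inl_inl] at h
    have hw : Near Lc (quo Lc u) w := by
      by_contra hn
      exact h (hessKerAt_eq_zero_left hr (f := (l, w)) hn _)
    have hy : Near Lc (quo Lc u) y := by
      by_contra hn
      exact h (hessKerAt_eq_zero_right hr (l, w) (f' := (l', y)) hn)
    have hc : (((2 * Lc : ℕ) : ℤ)) = 2 * (Lc : ℤ) := by push_cast; ring
    refine ⟨mem_colBox_iff.mpr fun i => ?_, mem_colBox_iff.mpr fun i => ?_⟩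
    · obtain ⟨h1, h2⟩ := hw i
      obtain ⟨h3, h4⟩ := hy i
      rw [hc]; constructor <;> omega
    · obtain ⟨h3, h4⟩ := hy i
      have hui : u i = (Lc : ℤ) * quo Lc u i := by
        have := congrFun e i
        simpa only [Pi.smul_apply, smul_eq_mul] using this
      rw [hc, hui]; constructor <;> omega
  · exact absurd (by rw [onLat_off _ hu]; rfl) h

omit [NeZero Lc] in
/-- [folklore] The synthetic table is bounded by `2ℓ²`, `ℓ = ell (d+1) Lc` (`abs_hessKer_le`). -/
theorem abs_onLat_hessFFAt_le (hLc : 1 ≤ Lc) (hr : r ∈ box (d + 1) Lc) (μ : Fin (d + 1)) (u w y : Fin (d + 1) → ℤ) (l l' : Fin (d + 1)) :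
    |onLat Lc (fun yy => -hessFFAt (toSite r) Lc μ yy) u w y (Sum.inl l) (Sum.inl l')| ≤ 2 * (ell (d + 1) Lc : ℝ) ^ 2 := by
  by_cases hu : Torus.proj Lc u = 0
  · simp only [onLat, hu, if_true, Pi.neg_apply, abs_neg, hessFFAt_inl_inl]
    exact abs_hessKerAt_le hLc μ _ hr _ _
  · rw [onLat_off _ hu]
    show |(0 : ℝ)| ≤ _
    rw [abs_zero]; positivity

omit [NeZero Lc] in
/-- [folklore] **BOUNDED COLUMN MASS** of the synthetic table (the `hmass` of `TaylorSandwich.sandwich_bound`), `N`-free and level-free: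
`Σ_{w ∈ box y} Σ_l Σ_μ Σ_{u ∈ box y} |T′ μ u w l y l′| ≤ (4Lc+1)^{2(d+1)}·(d+1)²·2ℓ²`. -/
theorem mass_onLat_hessFFAt (hLc : 1 ≤ Lc) (hr : r ∈ box (d + 1) Lc) (y : Fin (d + 1) → ℤ) (l' : Fin (d + 1)) :
    ∑ w ∈ Fintype.piFinset (fun i => Finset.Icc (y i - ((2 * Lc : ℕ) : ℤ)) (y i + ((2 * Lc : ℕ) : ℤ))),
      ∑ l : Fin (d + 1), ∑ μ : Fin (d + 1),
        ∑ u ∈ Fintype.piFinset (fun i => Finset.Icc (y i - ((2 * Lc : ℕ) : ℤ)) (y i + ((2 * Lc : ℕ) : ℤ))),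
          |onLat Lc (fun yy => -hessFFAt (toSite r) Lc μ yy) u w y (Sum.inl l) (Sum.inl l')| ≤
      ((2 * (2 * Lc) + 1) ^ (d + 1) : ℕ) * ((d + 1) * ((d + 1) * (((2 * (2 * Lc) + 1) ^ (d + 1) : ℕ) *
        (2 * (ell (d + 1) Lc : ℝ) ^ 2)))) := by
  have hcard := card_colBox (d := d) (R := 2 * Lc) y
  calc _ ≤ ∑ _w ∈ Fintype.piFinset (fun i => Finset.Icc (y i - ((2 * Lc : ℕ) : ℤ)) (y i + ((2 * Lc : ℕ) : ℤ))),
        ∑ _l : Fin (d + 1), ∑ _μ : Fin (d + 1),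
          ∑ _u ∈ Fintype.piFinset (fun i => Finset.Icc (y i - ((2 * Lc : ℕ) : ℤ)) (y i + ((2 * Lc : ℕ) : ℤ))),
            (2 * (ell (d + 1) Lc : ℝ) ^ 2) :=
        Finset.sum_le_sum fun w _ => Finset.sum_le_sum fun l _ => Finset.sum_le_sum fun μ _ =>
          Finset.sum_le_sum fun u _ => abs_onLat_hessFFAt_le hLc hr μ u w y l l'
    _ = _ := by
        simp only [Finset.sum_const, Finset.card_univ, Fintype.card_fin, nsmul_eq_mul, hcard]
        push_cast
        ring

end Synthetic

end Summit.QuantumFields.BalabanUV.Beta.GAN24.S3ShapeL0ContractionAt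

end
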